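import Summits.HodgeConjecture.CorCM.GaloisRightStabiliserDegenerate
import Mathlib.LinearAlgebra.Matrix.GeneralLinearGroup.Defs
import HarnessLib

/-!
# `Gal(K/ℚ) ≅ 2O` (binary octahedral group, order `48`, complex conjugation = the unique involution): simple DEGENERATE CM abelian
# 24-folds by a SKEW certificate on a TABLE model — and the table bridge for skew certificates

COR-CM (cell `pub-hodgecm2`), binder seat b04 (gen 33), count-neutral own lane «Galois-CM-type classification».  KERNEL ONLY:
theorems; no definition, no named fact, no `sorry`.  `HC_CM` is neither used nor claimed.  The binary octahedral group `2O = 2·S₄`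
(the non-split double cover of `S₄` isoclinic to `GL(2,3)`) has no Mathlib model; it is given as the TABLE `X = GL (Fin 2) (ZMod 3)`
with the twisted law `g ∘ h = -gh` if `det g = det h = -1`, `g ∘ h = gh` otherwise (the quotient of the fibre product
`GL(2,3) ×_{±1} C₄` by `(-1, -1)`; element orders `1, 2, 3⁸, 4¹⁸, 6⁸, 8¹²`, one involution).  `2O` has a non-normal subgroup of
order `3`, but `|2O| = 48 < 84` is below the count of `CorCM/GaloisNonNormalPrimeOrder`; the seat's census nevertheless finds `192`
skew sections among the `256` (scratch-g33/two_oct.py), and ONE is certified here by `decide` through gen 23's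
`GaloisModels.exists_simple_degenerate_of_model_skew`, transported along the table:

* `exists_simple_degenerate_of_table_skew` — the bridge: a table model `e : Gal(K/ℚ) ≃ X` (law `mul`, unique idempotent), the
  complex conjugation located as `xc`, a set `T ⊆ X` that is CM for `xc`, has trivial left stabiliser and a right stabiliser
  `xu ≠ 1` — all decidable on `X` — ⟹ a simple DEGENERATE abelian variety of dimension `|X|/2` with CM by `K`.
* `exists_simple_degenerate_of_table_binary_octahedral` — **`Gal(K/ℚ) ≅ 2O` ⟹ a simple DEGENERATE abelian `24`-fold with CM by
  `K`**.  `2O` has a unique involution, its normal subgroups `≠ 1` (`Z, Q₈, 2T, 2O`) contain it, its one index-two subgroup `2T`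
  contains it: no CM quotient, no imaginary quadratic subfield, no totally real factor, no abelian subgroup of index two — outside
  every criterion of gens 19–33 (row «2O» of A7-JUNCTION gen-33 §D).

## References

* [Shimura1998] G. Shimura, *Abelian Varieties with Complex Multiplication and Modular Functions*, §6.2 Thm. 3, §8.2 Prop. 26, §32.10.
* [Gordon1999HodgeAVSurvey] B. B. Gordon, *A survey of the Hodge conjecture for abelian varieties*, Thm. 6.4, §9.3.
-/

noncomputable section

open CategoryTheory CategoryTheory.Limits NumberField
open scoped BigOperators MatrixGroups

namespace Summit.HodgeConjecture.CorCM.GaloisModels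

open Literature.NumberTheory.ComplexMultiplication
open Literature.AlgebraicGeometry.Motives (AbelianVariety CMType)
open Literature.AlgebraicGeometry.HodgeTheory
open Literature.AlgebraicGeometry.ComplexMultiplication (IsCMTypeRealisation)
open Literature.AlgebraicGeometry.Pohlmann1968
open Literature.Barriers.HodgeConjecture (divisorClassesSpan)
open Summit.HodgeConjecture.CorCM.GaloisRank
open Summit.HodgeConjecture.CorCM.GaloisOctic (complexConj_mul_comm complexConj_mul_self)

variable {K : Type} [Field K] [NumberField K] [IsCMField K] [IsGalois ℚ K]

/-- **TABLE BRIDGE FOR SKEW CERTIFICATES.**  `e : Gal(K/ℚ) ≃ X` a bijection with `e(ab) = mul (e a) (e b)` and `one` the only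
idempotent; `xc = e(complex conjugation)`; `T ⊆ X` with `x ∈ T ↔ xc·x ∉ T`, `∀ v ≠ one, ∃ w, ¬(w ∈ T ↔ v·w ∈ T)` and `T·xu = T` for some
`xu ≠ one` ⟹ a simple DEGENERATE abelian variety of dimension `|X|/2` with CM by `K` and a rational `(q,q)` class outside the divisor
ring on some power. [cite: Shimura1998, §6.2 Thm. 3, §8.2 Prop. 26 and §32.10] [cite: Gordon1999HodgeAVSurvey, Thm. 6.4 and §9.3] -/
theorem exists_simple_degenerate_of_table_skew {X : Type*} [Fintype X] [DecidableEq X]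
    (e : (K ≃ₐ[ℚ] K) ≃ X) (mul : X → X → X) (hmul : ∀ a b : K ≃ₐ[ℚ] K, e (a * b) = mul (e a) (e b)) (one : X)
    (hidem : ∀ x : X, mul x x = x → x = one) (xc : X) (hc : e ((IsCMField.complexConj K).restrictScalars ℚ) = xc)
    (T : Finset X) (hcm : ∀ x : X, x ∈ T ↔ mul xc x ∉ T) (hprim : ∀ v : X, v ≠ one → ∃ w : X, ¬ (w ∈ T ↔ mul v w ∈ T))
    (xu : X) (hu : xu ≠ one) (hTu : ∀ x : X, mul x xu ∈ T ↔ x ∈ T) :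
    ∃ (Φ : CMType K) (φ₀ : K →+* ℂ) (A : AbelianVariety ℂ) (ι : 𝓞 K →+* End A)
      (θ : K →+* Module.End ℂ (complexBetti A.X 1)),
      IsPrimitive (ℂ ≃+* ℂ) Φ.1 φ₀ ∧ ¬ IsNondegenerate Φ ∧ IsCMTypeRealisation Φ A ι θ ∧ A.IsSimple ∧
      A.dim = Fintype.card X / 2 ∧
      ∃ n p : ℕ, ∃ x : complexBetti (⨁ fun _ : Fin n => A).X (2 * p), IsRationalClass x ∧
        IsOfHodgeType (⨁ fun _ : Fin n => A).dim (⨁ fun _ : Fin n => A).X (2 * p) p p x ∧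
        x ∉ divisorClassesSpan (⨁ fun _ : Fin n => A).X (⨁ fun _ : Fin n => A).dim p := by
  classical
  have hone : e 1 = one := hidem _ (by rw [← hmul, mul_one])
  have hsymm : ∀ x : X, e (e.symm x) = x := fun x => e.apply_symm_apply x
  set T' : Finset (K ≃ₐ[ℚ] K) := Finset.univ.filter (fun g => e g ∈ T) with hT'
  have hmem : ∀ g : K ≃ₐ[ℚ] K, g ∈ T' ↔ e g ∈ T := fun g => by
    rw [hT', Finset.mem_filter, and_iff_right (Finset.mem_univ g)]
  have hcm' : ∀ g : K ≃ₐ[ℚ] K, g ∈ T' ↔ (IsCMField.complexConj K).restrictScalars ℚ * g ∉ T' := fun g => by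
    rw [hmem, hmem, hmul, hc]; exact hcm (e g)
  have hprim' : ∀ v : K ≃ₐ[ℚ] K, v ≠ 1 → ∃ w : K ≃ₐ[ℚ] K, ¬ (w ∈ T' ↔ v * w ∈ T') := by
    intro v hv
    obtain ⟨w₀, hw₀⟩ := hprim (e v) (fun h => hv (e.injective (h.trans hone.symm)))
    exact ⟨e.symm w₀, by rw [hmem, hmem, hmul, hsymm]; exact hw₀⟩
  have hu' : e.symm xu ≠ 1 := fun h => hu (by rw [← hsymm xu, h, hone])
  have hTu' : ∀ g : K ≃ₐ[ℚ] K, g * e.symm xu ∈ T' ↔ g ∈ T' := fun g => by rw [hmem, hmem, hmul, hsymm]; exact hTu (e g)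
  obtain ⟨Φ, φ₀, A, ι, θ, H1, H2, H3, H4, H5, H6⟩ :=
    exists_simple_degenerate_of_model_skew (MulEquiv.refl (K ≃ₐ[ℚ] K)) _ rfl T' hcm' hprim' hu' hTu'
  exact ⟨Φ, φ₀, A, ι, θ, H1, H2, H3, H4, by rw [H5, Fintype.card_congr e], H6⟩

set_option synthInstance.maxSize 4096 in
set_option maxHeartbeats 1000000 in
/-- `2O` as the table `GL(2,3)` with the twisted law: `1` is the only idempotent, `-1` the only central involution, `|X| = 48`.
[folklore] -/
theorem binary_octahedral_table_basics :
    (∀ x : GL (Fin 2) (ZMod 3), (fun g h : GL (Fin 2) (ZMod 3) =>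
        if Matrix.GeneralLinearGroup.det g = -1 ∧ Matrix.GeneralLinearGroup.det h = -1 then -(g * h) else g * h) x x = x → x = 1) ∧
    (∀ x : GL (Fin 2) (ZMod 3), (fun g h : GL (Fin 2) (ZMod 3) =>
        if Matrix.GeneralLinearGroup.det g = -1 ∧ Matrix.GeneralLinearGroup.det h = -1 then -(g * h) else g * h) x x = 1 → x ≠ 1 →
      (∀ y : GL (Fin 2) (ZMod 3), (fun g h : GL (Fin 2) (ZMod 3) =>
        if Matrix.GeneralLinearGroup.det g = -1 ∧ Matrix.GeneralLinearGroup.det h = -1 then -(g * h) else g * h) x y = (fun g h : GL (Fin 2) (ZMod 3) =>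
        if Matrix.GeneralLinearGroup.det g = -1 ∧ Matrix.GeneralLinearGroup.det h = -1 then -(g * h) else g * h) y x) → x = -1) ∧
    Fintype.card (GL (Fin 2) (ZMod 3)) = 48 := by
  refine ⟨by decide +kernel, by decide +kernel, by decide +kernel⟩

set_option synthInstance.maxSize 4096 in
set_option maxHeartbeats 1000000 in
/-- The skew certificate for `2O`: the displayed `24`-element set (cut out by matrix entries) is CM for `-1`, has trivial LEFT
stabiliser under the twisted law, and is RIGHT-invariant under some `xu ≠ 1`. [folklore] -/
theorem binary_octahedral_skew_certificate :
    (∀ x : GL (Fin 2) (ZMod 3), x ∈ (Finset.univ.filter fun g : GL (Fin 2) (ZMod 3) =>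
        (((g : Matrix (Fin 2) (Fin 2) (ZMod 3)) 0 0, (g : Matrix (Fin 2) (Fin 2) (ZMod 3)) 0 1,
          (g : Matrix (Fin 2) (Fin 2) (ZMod 3)) 1 0, (g : Matrix (Fin 2) (Fin 2) (ZMod 3)) 1 1) : ZMod 3 × ZMod 3 × ZMod 3 × ZMod 3) ∈
          ({(0, 1, 1, 0), (0, 1, 1, 1), (0, 1, 1, 2), (0, 1, 2, 0), (0, 1, 2, 1), (0, 2, 1, 1), (1, 0, 0, 2), (1, 0, 1, 1), (1, 0, 1, 2), (1, 0, 2, 1), (1, 0, 2, 2), (1, 1, 2, 0), (1, 2, 0, 1), (1, 2, 0, 2), (1, 2, 1, 0), (1, 2, 1, 1), (1, 2, 2, 0), (1, 2, 2, 2), (2, 0, 0, 2), (2, 2, 0, 1), (2, 2, 0, 2), (2, 2, 1, 2), (2, 2, 2, 0), (2, 2, 2, 1)} : Finset (ZMod 3 × ZMod 3 × ZMod 3 × ZMod 3))) ↔ (fun g h : GL (Fin 2) (ZMod 3) =>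
        if Matrix.GeneralLinearGroup.det g = -1 ∧ Matrix.GeneralLinearGroup.det h = -1 then -(g * h) else g * h) (-1) x ∉ (Finset.univ.filter fun g : GL (Fin 2) (ZMod 3) =>
        (((g : Matrix (Fin 2) (Fin 2) (ZMod 3)) 0 0, (g : Matrix (Fin 2) (Fin 2) (ZMod 3)) 0 1,
          (g : Matrix (Fin 2) (Fin 2) (ZMod 3)) 1 0, (g : Matrix (Fin 2) (Fin 2) (ZMod 3)) 1 1) : ZMod 3 × ZMod 3 × ZMod 3 × ZMod 3) ∈
          ({(0, 1, 1, 0), (0, 1, 1, 1), (0, 1, 1, 2), (0, 1, 2, 0), (0, 1, 2, 1), (0, 2, 1, 1), (1, 0, 0, 2), (1, 0, 1, 1), (1, 0, 1, 2), (1, 0, 2, 1), (1, 0, 2, 2), (1, 1, 2, 0), (1, 2, 0, 1), (1, 2, 0, 2), (1, 2, 1, 0), (1, 2, 1, 1), (1, 2, 2, 0), (1, 2, 2, 2), (2, 0, 0, 2), (2, 2, 0, 1), (2, 2, 0, 2), (2, 2, 1, 2), (2, 2, 2, 0), (2, 2, 2, 1)} : Finset (ZMod 3 × ZMod 3 ×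 ZMod 3 × ZMod 3)))) ∧
    (∀ v : GL (Fin 2) (ZMod 3), v ≠ 1 → ∃ w : GL (Fin 2) (ZMod 3), ¬ (w ∈ (Finset.univ.filter fun g : GL (Fin 2) (ZMod 3) =>
        (((g : Matrix (Fin 2) (Fin 2) (ZMod 3)) 0 0, (g : Matrix (Fin 2) (Fin 2) (ZMod 3)) 0 1,
          (g : Matrix (Fin 2) (Fin 2) (ZMod 3)) 1 0, (g : Matrix (Fin 2) (Fin 2) (ZMod 3)) 1 1) : ZMod 3 × ZMod 3 × ZMod 3 × ZMod 3) ∈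
          ({(0, 1, 1, 0), (0, 1, 1, 1), (0, 1, 1, 2), (0, 1, 2, 0), (0, 1, 2, 1), (0, 2, 1, 1), (1, 0, 0, 2), (1, 0, 1, 1), (1, 0, 1, 2), (1, 0, 2, 1), (1, 0, 2, 2), (1, 1, 2, 0), (1, 2, 0, 1), (1, 2, 0, 2), (1, 2, 1, 0), (1, 2, 1, 1), (1, 2, 2, 0), (1, 2, 2, 2), (2, 0, 0, 2), (2, 2, 0, 1), (2, 2, 0, 2), (2, 2, 1, 2), (2, 2, 2, 0), (2, 2, 2, 1)} : Finset (ZMod 3 × ZMod 3 × ZMod 3 × ZMod 3))) ↔ (fun g h : GL (Fin 2) (ZMod 3) =>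
        if Matrix.GeneralLinearGroup.det g = -1 ∧ Matrix.GeneralLinearGroup.det h = -1 then -(g * h) else g * h) v w ∈ (Finset.univ.filter fun g : GL (Fin 2) (ZMod 3) =>
        (((g : Matrix (Fin 2) (Fin 2) (ZMod 3)) 0 0, (g : Matrix (Fin 2) (Fin 2) (ZMod 3)) 0 1,
          (g : Matrix (Fin 2) (Fin 2) (ZMod 3)) 1 0, (g : Matrix (Fin 2) (Fin 2) (ZMod 3)) 1 1) : ZMod 3 × ZMod 3 × ZMod 3 × ZMod 3) ∈
          ({(0, 1, 1, 0), (0, 1, 1, 1), (0, 1, 1, 2), (0, 1, 2, 0), (0, 1, 2, 1), (0, 2, 1, 1), (1, 0, 0, 2), (1, 0, 1, 1), (1, 0, 1, 2), (1, 0, 2, 1), (1, 0, 2, 2), (1, 1, 2, 0), (1, 2, 0, 1), (1, 2, 0, 2), (1, 2, 1, 0), (1, 2, 1, 1), (1, 2, 2, 0), (1, 2, 2, 2), (2, 0, 0, 2), (2, 2, 0, 1), (2, 2, 0, 2), (2, 2, 1, 2), (2, 2, 2, 0), (2, 2, 2, 1)} : Finset (ZMod 3 × ZMod 3 × ZMod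 3 × ZMod 3))))) ∧
    (∃ xu : GL (Fin 2) (ZMod 3), xu ≠ 1 ∧ ∀ x : GL (Fin 2) (ZMod 3), (fun g h : GL (Fin 2) (ZMod 3) =>
        if Matrix.GeneralLinearGroup.det g = -1 ∧ Matrix.GeneralLinearGroup.det h = -1 then -(g * h) else g * h) x xu ∈ (Finset.univ.filter fun g : GL (Fin 2) (ZMod 3) =>
        (((g : Matrix (Fin 2) (Fin 2) (ZMod 3)) 0 0, (g : Matrix (Fin 2) (Fin 2) (ZMod 3)) 0 1,
          (g : Matrix (Fin 2) (Fin 2) (ZMod 3)) 1 0, (g : Matrix (Fin 2) (Fin 2) (ZMod 3)) 1 1) : ZMod 3 × ZMod 3 × ZMod 3 × ZMod 3) ∈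
          ({(0, 1, 1, 0), (0, 1, 1, 1), (0, 1, 1, 2), (0, 1, 2, 0), (0, 1, 2, 1), (0, 2, 1, 1), (1, 0, 0, 2), (1, 0, 1, 1), (1, 0, 1, 2), (1, 0, 2, 1), (1, 0, 2, 2), (1, 1, 2, 0), (1, 2, 0, 1), (1, 2, 0, 2), (1, 2, 1, 0), (1, 2, 1, 1), (1, 2, 2, 0), (1, 2, 2, 2), (2, 0, 0, 2), (2, 2, 0, 1), (2, 2, 0, 2), (2, 2, 1, 2), (2, 2, 2, 0), (2, 2, 2, 1)} : Finset (ZMod 3 × ZMod 3 × ZMod 3 × ZMod 3))) ↔ x ∈ (Finset.univ.filter fun g : GL (Fin 2) (ZMod 3) =>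
        (((g : Matrix (Fin 2) (Fin 2) (ZMod 3)) 0 0, (g : Matrix (Fin 2) (Fin 2) (ZMod 3)) 0 1,
          (g : Matrix (Fin 2) (Fin 2) (ZMod 3)) 1 0, (g : Matrix (Fin 2) (Fin 2) (ZMod 3)) 1 1) : ZMod 3 × ZMod 3 × ZMod 3 × ZMod 3) ∈
          ({(0, 1, 1, 0), (0, 1, 1, 1), (0, 1, 1, 2), (0, 1, 2, 0), (0, 1, 2, 1), (0, 2, 1, 1), (1, 0, 0, 2), (1, 0, 1, 1), (1, 0, 1, 2), (1, 0, 2, 1), (1, 0, 2, 2), (1, 1, 2, 0), (1, 2, 0, 1), (1, 2, 0, 2), (1, 2, 1, 0), (1, 2, 1, 1), (1, 2, 2, 0), (1, 2, 2, 2), (2, 0, 0, 2), (2, 2, 0, 1), (2, 2, 0, 2), (2, 2, 1, 2), (2, 2, 2, 0), (2, 2, 2, 1)} : Finset (ZMod 3 × ZMod 3 × ZMod 3 × ZMod 3)))) := by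
  refine ⟨by decide +kernel, by decide +kernel, by decide +kernel⟩

set_option maxRecDepth 8192 in
set_option maxHeartbeats 1000000 in
/-- **`Gal(K/ℚ) ≅ 2O` (binary octahedral, as the twisted table on `GL(2,3)`): a simple DEGENERATE abelian `24`-fold with CM by
`K`**, with a rational `(q,q)` class outside the divisor ring on some power.
[cite: Shimura1998, §6.2 Thm. 3, §8.2 Prop. 26 and §32.10] [cite: Gordon1999HodgeAVSurvey, Thm. 6.4 and §9.3] -/
theorem exists_simple_degenerate_of_table_binary_octahedral (e : (K ≃ₐ[ℚ] K) ≃ GL (Fin 2) (ZMod 3))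
    (hmul : ∀ a b : K ≃ₐ[ℚ] K, e (a * b) = (fun g h : GL (Fin 2) (ZMod 3) =>
        if Matrix.GeneralLinearGroup.det g = -1 ∧ Matrix.GeneralLinearGroup.det h = -1 then -(g * h) else g * h) (e a) (e b)) :
    ∃ (Φ : CMType K) (φ₀ : K →+* ℂ) (A : AbelianVariety ℂ) (ι : 𝓞 K →+* End A)
      (θ : K →+* Module.End ℂ (complexBetti A.X 1)),
      IsPrimitive (ℂ ≃+* ℂ) Φ.1 φ₀ ∧ ¬ IsNondegenerate Φ ∧ IsCMTypeRealisation Φ A ι θ ∧ A.IsSimple ∧ A.dim = 24 ∧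
      ∃ n p : ℕ, ∃ x : complexBetti (⨁ fun _ : Fin n => A).X (2 * p), IsRationalClass x ∧
        IsOfHodgeType (⨁ fun _ : Fin n => A).dim (⨁ fun _ : Fin n => A).X (2 * p) p p x ∧
        x ∉ divisorClassesSpan (⨁ fun _ : Fin n => A).X (⨁ fun _ : Fin n => A).dim p := by
  classical
  obtain ⟨hidem, hcentral, hcard⟩ := binary_octahedral_table_basics
  obtain ⟨hcm, hprim, xu, hu, hTu⟩ := binary_octahedral_skew_certificate
  have hone : e 1 = 1 := hidem _ (by rw [← hmul, mul_one])
  -- locate the complex conjugation: a central involution of the table, hence `-1`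
  have hc : e ((IsCMField.complexConj K).restrictScalars ℚ) = -1 := by
    refine hcentral _ ?_ ?_ ?_
    · rw [← hmul, complexConj_mul_self, hone]
    · intro h
      exact model_complexConj_ne_one (MulEquiv.refl (K ≃ₐ[ℚ] K)) rfl (e.injective (h.trans hone.symm))
    · intro y
      rw [← e.apply_symm_apply y, ← hmul, ← hmul, complexConj_mul_comm]
  obtain ⟨Φ, φ₀, A, ι, θ, H1, H2, H3, H4, H5, H6⟩ :=
    exists_simple_degenerate_of_table_skew e _ hmul 1 hidem (-1) hc _ hcm hprim xu hu hTu
  exact ⟨Φ, φ₀, A, ι, θ, H1, H2, H3, H4, by rw [H5, hcard], H6⟩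

end Summit.HodgeConjecture.CorCM.GaloisModels

end
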